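import Mathlib
import Summits.ValiantsHypothesis.ValiantsHypothesis.Theorems.RigidityForcesSymmetryRankRigidMinimalReprTiedTorusBoundOfLevelDecomp
import Summits.ValiantsHypothesis.ValiantsHypothesis.Theorems.RigidityForcesSymmetryRankRigidMinimalReprStubLevelDecomp

/-!
# The rungs `TiedTorusBound 1` (= `PairTiedTorusBound`) and `TiedTorusBound 2` — UNCONDITIONAL
# (crux `RankRigidMinimalRepr`, stmt-ValiantsHypothesis-18034, route `RigidityForcesSymmetry`)

`…RankRigidMinimalReprTiedTorusBoundOfLevelDecomp.lean` (p548171) derived the rungs `TiedTorusBound 1` and `TiedTorusBound 2`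
of the line `PairTiedTorusBound` from the dictionary statement taken as a HYPOTHESIS `hdec` (verbatim the registered stub
`stub_levelDecomp`); `…RankRigidMinimalReprStubLevelDecomp.lean` now PROVES `stub_levelDecomp`.  This file discharges the
hypothesis:

* `tiedTorusBound_one : TiedTorusBound 1` — Grenet's bound `2^m - 1 ≤ n` (`m ≥ 3`) for every affine determinantal
  representation of `perm_m` over `ℂ` of size `n` which is equivariant (exact `GL_n × GL_n` lifts, `IsEquivariantDetRepr`)
  under the two-sided torus `x_{ij} ↦ d_i e_j x_{ij}` with ONE PAIR of column scalars tied (`e_0 = e_1`) — the rung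
  `PairTiedTorusBound` of the line, over the tree copies `tiedTorus` / `TiedTorusBound` (`…RankRigidMinimalReprTiedTorusDefs.lean`,
  verbatim the workfile's `Cruxes/RankRigidMinimalRepr/Lines/PairTiedTorusBound.lean`, which `Theorems/` cannot import);
* `tiedTorusBound_two : TiedTorusBound 2` — the same with the THREE column scalars `e_0 = e_1 = e_2` tied;
* `grenetBound_of_laplaceOptimal : LaplaceOptimal (k+1) → (Grenet's bound for `tiedTorus m k`, `m ≥ max 3 (k+1)`)` and
  `tiedTorusBound_of_laplaceOptimal_ge_four : (∀ d ≥ 4, LaplaceOptimal d) → ∀ k, TiedTorusBound k` — the remaining ladder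
  (up to all columns tied = the row torus with one common column scalar) is now conditional ONLY on the finite statements
  `LaplaceOptimal d`, `d ≥ 4` (open; border-false at `4`, evidence on the item).

HONEST FRAMING: forward rungs (hypothesis of the PROVED floor `TorusBound` weakened to a codimension-1 / -2 subtorus) inside
one route; the crux `RankRigidMinimalRepr` (stmt-18034) itself stays OPEN and is calibrated equal to the route's target
(`GrenetLowerBound`); census-neutral; `VP ≠ VNP` is NOT proved and nothing here is progress on it.
-/

set_option autoImplicit false

-- the mandated summit-side namespace repeats a component by design (single-problem summit)
set_option linter.dupNamespace false

open Literature.Computability.AlgebraicComplexity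
open Summit.ValiantsHypothesis.ValiantsHypothesis.Theorems.RigidityForcesSymmetryPairTiedTorusBound

namespace Summit.ValiantsHypothesis.ValiantsHypothesis.Theorems.RigidityForcesSymmetryRankRigidMinimalRepr

/-- **The rung `PairTiedTorusBound = TiedTorusBound 1`, unconditionally**: for `m ≥ 3`, every affine determinantal
representation of `perm_m` over `ℂ` equivariant (exact lifts) under the two-sided torus with the column scalars `e_0 = e_1`
tied has size `n ≥ 2^m - 1`.  (Dictionary `stub_levelDecomp` + count `stub_levelBound` / `laplaceOptimal_two`, composed by
`tiedTorusBound_one_of_levelDecomp`.) [cite: LandsbergRessayre2017, Thm. 2.8, §6] -/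
theorem tiedTorusBound_one : TiedTorusBound 1 :=
  tiedTorusBound_one_of_levelDecomp stub_levelDecomp

/-- **The next rung `TiedTorusBound 2`, unconditionally**: the same bound with the three column scalars `e_0 = e_1 = e_2`
tied (dictionary + `levelBound_threeTied` / `laplaceOptimal_three`). [cite: LandsbergRessayre2017, Thm. 2.8, §6] -/
theorem tiedTorusBound_two : TiedTorusBound 2 :=
  tiedTorusBound_two_of_levelDecomp stub_levelDecomp

/-- **The ladder above, conditional only on the finite statement `LaplaceOptimal (k+1)`**: Grenet's bound for
`tiedTorus m k`-equivariant representations of `perm_m`, `m ≥ max 3 (k+1)`, from `LaplaceOptimal (k + 1)` alone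
(the dictionary being proved). -/
theorem grenetBound_of_laplaceOptimal {k : ℕ} (hL : LaplaceOptimal (k + 1)) :
    ∀ m : ℕ, 3 ≤ m → k + 1 ≤ m → ∀ (n : ℕ) (A : Matrix (Fin n) (Fin n) (MvPolynomial (Fin m × Fin m) ℂ)),
      IsEquivariantDetRepr (tiedTorus m k) (perPoly (Fin m) ℂ) A → 2 ^ m - 1 ≤ n :=
  grenetBound_of_levelDecomp_of_laplaceOptimal stub_levelDecomp hL

/-- The smallest tied torus `tiedTorus m (m - 1)` (ALL column scalars tied: the row torus with one common column
scalar) lies in every `tiedTorus m k` (and equals it for `m ≤ k + 1`). -/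
theorem tiedTorus_sub_one_le (m k : ℕ) : tiedTorus m (m - 1) ≤ tiedTorus m k := by
  refine Subgroup.closure_mono ?_
  rintro γ ⟨d, e, he, hγ⟩
  exact ⟨d, e, fun j j' _ _ => he j j' (by have := j.isLt; omega) (by have := j'.isLt; omega), hγ⟩

/-- **The whole ladder reduces to the finite statements `LaplaceOptimal d`, `d ≥ 4`**: if Laplace expansion is
optimal for the permutation pattern of every order `d ≥ 4` (orders `1, 2, 3` are the landed `laplaceOptimal_one/two/three`),
then `TiedTorusBound k` holds for EVERY `k` — in particular for `k + 1 ≥ m` (all column scalars tied, i.e. equivariance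
under the ROW torus with one common column scalar), Grenet's `2^m - 1` would be optimal for such representations.  (The
hypothesis is open and expected to be hard: see the caveat in `…LaplaceDefs.lean`; `LaplaceOptimal 4` is border-false,
evidence on the item.)  Conditional statement; nothing is claimed about the hypothesis. -/
theorem tiedTorusBound_of_laplaceOptimal_ge_four (hL : ∀ d : ℕ, 4 ≤ d → LaplaceOptimal d) (k : ℕ) :
    TiedTorusBound k := by
  have hL' : ∀ d : ℕ, 1 ≤ d → LaplaceOptimal d := fun d hd => by
    rcases (show d = 1 ∨ d = 2 ∨ d = 3 ∨ 4 ≤ d by omega) with rfl | rfl | rfl | h4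
    · exact laplaceOptimal_one
    · exact laplaceOptimal_two
    · exact laplaceOptimal_three
    · exact hL d h4
  intro m hm n A hA
  by_cases hk : k + 1 ≤ m
  · exact grenetBound_of_levelDecomp_of_laplaceOptimal stub_levelDecomp (hL' (k + 1) (by omega)) m hm hk n A hA
  · have h1 : m - 1 + 1 ≤ m := by omega
    exact grenetBound_of_levelDecomp_of_laplaceOptimal stub_levelDecomp (k := m - 1) (hL' (m - 1 + 1) (by omega))
      m hm h1 n A (hA.anti (tiedTorus_sub_one_le m k))

end Summit.ValiantsHypothesis.ValiantsHypothesis.Theorems.RigidityForcesSymmetryRankRigidMinimalRepr
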